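import Mathlib.Algebra.Module.LocalizedModule.Basic
import Mathlib.RingTheory.Localization.Defs
import Mathlib.RingTheory.Ideal.Maps
import Mathlib.RingTheory.Finiteness.Defs
import Mathlib.Algebra.BigOperators.Group.Finset.Basic
import HarnessLib

/-!
# The annihilator of a finite module commutes with localization

Topic: `Literature/AlgebraicGeometry/Resolution` (input for the localization-compatibility of the
`Ext`-annihilator ideals of Macaulayfication, `ExtAnnihilatorAffineGlobal.lean`).

* `annihilator_map_le_annihilator_of_isLocalizedModule` — `(Ann_R M) R_S ⊆ Ann_{R_S} M_S` for ANY
  `R`-module `M` and any model `f : M → M_S` of the localization (`IsLocalizedModule S f`);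
* `annihilator_eq_map_of_isLocalizedModule` — **equality for `M` finite**:
  `Ann_{R_S} M_S = (Ann_R M) R_S` (if `r/1` kills `M_S` then for generators `m₁,…,m_k` of `M`
  some `tᵢ ∈ S` kills `r mᵢ`, so `(∏ tᵢ) r ∈ Ann M`).

[cite: AtiyahMacdonald1969, Prop. 3.14 ("if `M` is finitely generated, `S⁻¹(Ann M) = Ann (S⁻¹M)`")]
-/

noncomputable section

open Module

universe u v w

namespace Literature.AlgebraicGeometry.Resolution

variable {R : Type u} [CommRing R] (S : Submonoid R) (R' : Type v) [CommRing R'] [Algebra R R']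
  [IsLocalization S R'] {M : Type w} [AddCommGroup M] [Module R M]
  {M' : Type w} [AddCommGroup M'] [Module R M'] [Module R' M'] [IsScalarTower R R' M']
  (f : M →ₗ[R] M') [IsLocalizedModule S f]

include S f in
/-- `(Ann_R M) · R_S ⊆ Ann_{R_S} M_S` for any model of the localized module. [folklore] -/
theorem annihilator_map_le_annihilator_of_isLocalizedModule :
    (Module.annihilator R M).map (algebraMap R R') ≤ Module.annihilator R' M' := by
  refine Ideal.map_le_iff_le_comap.mpr fun z hz => ?_
  rw [Ideal.mem_comap, Module.mem_annihilator]
  intro m'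
  obtain ⟨⟨m, s⟩, hm⟩ := IsLocalizedModule.surj S f m'
  -- `hm : s • m' = f m`; `z • f m = f (z • m) = 0`, and `s` acts invertibly
  have hzm : f (z • m) = 0 := by rw [Module.mem_annihilator.mp hz m, map_zero]
  have hunit : IsUnit (algebraMap R R' (s : R)) := IsLocalization.map_units R' s
  have hs : algebraMap R R' (s : R) • (algebraMap R R' z • m') = 0 := by
    rw [smul_comm, algebraMap_smul R' (s : R) m']
    have hm' : (s : R) • m' = f m := hm
    change algebraMap R R' z • ((s : R) • m') = 0
    rw [hm', algebraMap_smul, ← map_smul, hzm]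
  have := congrArg (fun w => (hunit.unit⁻¹ : R'ˣ) • w) hs
  simpa only [smul_zero, Units.smul_def, ← mul_smul, ← mul_assoc, IsUnit.val_inv_mul, one_mul]
    using this

include S f in
/-- **`Ann_{R_S} M_S = (Ann_R M) · R_S` for a finite module `M`.**
[cite: AtiyahMacdonald1969, Prop. 3.14] -/
theorem annihilator_eq_map_of_isLocalizedModule [Module.Finite R M] :
    Module.annihilator R' M' = (Module.annihilator R M).map (algebraMap R R') := by
  classical
  refine le_antisymm ?_ (annihilator_map_le_annihilator_of_isLocalizedModule S R' f)
  intro x hx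
  obtain ⟨⟨r, s⟩, hxrs⟩ := IsLocalization.surj S x
  -- `hxrs : x * algebraMap s = algebraMap r`; so `algebraMap r` kills `M'`
  have hr : ∀ m' : M', algebraMap R R' r • m' = 0 := fun m' => by
    rw [← hxrs, mul_comm, mul_smul, Module.mem_annihilator.mp hx, smul_zero]
  -- for each `m`: `f (r • m) = r • f m = 0`, so some `t ∈ S` kills `r • m`
  have ht : ∀ m : M, ∃ t : S, t • (r • m) = 0 := fun m => by
    have h0 : f (r • m) = 0 := by rw [map_smul, ← algebraMap_smul R' r, hr]
    exact (IsLocalizedModule.eq_zero_iff S f).mp h0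
  choose t ht using ht
  obtain ⟨G, hG⟩ := Module.Finite.fg_top (R := R) (M := M)
  -- `T = ∏_{m ∈ G} t m` kills `r • m` for all generators, hence `T r ∈ Ann M`
  have hTr : ((∏ m ∈ G, t m : S) : R) * r ∈ Module.annihilator R M := by
    rw [Module.mem_annihilator]
    suffices h : ∀ m ∈ Submodule.span R (G : Set M), (((∏ m ∈ G, t m : S) : R) * r) • m = 0 by
      intro m; exact h m (hG ▸ Submodule.mem_top)
    intro m hm
    induction hm using Submodule.span_induction with
    | mem m hmG =>
      obtain ⟨u, hu⟩ : ∃ u : S, (∏ m ∈ G, t m : S) = u * t m :=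
        ⟨∏ m' ∈ G.erase m, t m', (Finset.prod_erase_mul G t hmG).symm⟩
      have htm := ht m
      rw [Submonoid.smul_def] at htm
      rw [hu, Submonoid.coe_mul, mul_assoc, mul_smul, mul_smul, htm, smul_zero]
    | zero => exact smul_zero _
    | add a b _ _ ha hb => rw [smul_add, ha, hb, add_zero]
    | smul c a _ ha => rw [smul_comm, ha, smul_zero]
  -- `x = (T r) / (T s)`
  have hx' : x = IsLocalization.mk' R' (((∏ m ∈ G, t m : S) : R) * r) ((∏ m ∈ G, t m) * s) := by
    rw [IsLocalization.eq_mk'_iff_mul_eq, Submonoid.coe_mul, map_mul, map_mul, ← hxrs]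
    ring
  rw [hx', IsLocalization.mk'_eq_mul_mk'_one]
  exact Ideal.mul_mem_right _ _ (Ideal.mem_map_of_mem _ hTr)

end Literature.AlgebraicGeometry.Resolution

end
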